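import Summits.ValiantsHypothesis.ValiantsHypothesis.Theorems.GeneratorObstructionsPerGenDegreeSuperQPRayCriterion
import Literature.Computability.AlgebraicComplexity.BI17FormPolystabilityCriterion
import Literature.Computability.AlgebraicComplexity.CapabilityBoundTower
import Literature.Computability.AlgebraicComplexity.OrbitClosureWeightDegenerations

/-!
# Route GeneratorObstructions — K1 `PerGenDegreeSuperQP` (stmt-ValiantsHypothesis-11654),
# line `per-side-atoms`: the CHOW RAYS `j ∣ m` of `S(per_m)` are hit (balanced monomials),
# so each carries an atom — first application of the ray criterion

Ninth support file of the line (companions `…AtomCertificates`, …, `…ExtremalRays`,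
`…RayCriterion`). `…RectangularRays` proved that every rectangular ray `ℝ₊(1^j)^*` of the
occurrence monoid `S(per_m)` that is HIT starts with an atom, and exhibited only the top ray
`j = m²` (`per_top_ray_hit`, polystability of `per_m`). `…RayCriterion` turned "ray `j` is hit"
into "some `j`-variable degeneration of `per_m` is `SL_j`-semistable". This file supplies the
degenerations for the divisors `j` of `m`:

* `rename_rowCollapse_perFormLex` — substituting `x_{ik} ↦ y_{c(k)}` (every row of the matrix
  replaced by the same vector of `j` variables `y`, the column `k` carrying `y_{c(k)}` for a
  balanced `c : Fin (ja) → Fin j`) turns `per_{ja}` into `(ja)! · (y₁⋯y_j)^a`; hence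
  (`balancedMonomial_mem_orbitClosure_per`) the BALANCED MONOMIAL `(y₁⋯y_j)^a`, placed on `j`
  diagonal matrix variables, lies in `Δ(per_{ja})` (endomorphism orbit; `Δ` is a cone).
* `(y₁⋯y_j)^a` is polystable (BI 2017 Cor. 2.9 / tree `isPolystable_prod_X_pow`), nonzero, of
  degree `ja`; so by the ray criterion (`exists_hasHighestWeight_rectangle_of_isSLSemistable_projection`)
  **the ray `j` of `S(per_{ja})` is hit** (`per_ray_hit_of_mul`), and by `…RectangularRays` it
  starts with an ATOM (`per_exists_ray_atom_of_mul`): for every factorisation `m = j·a`,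
  `j, a ≥ 1`, the occurrence monoid of the permanent has an atom of the shape `(k^j)^*`.

These are the "Chow rays" (`j ≤ m`): the first-occurrence degree on ray `j` is at most the least
degree of an `SL_j`-invariant not vanishing at the balanced monomial, BI 2017's `e((y₁⋯y_j)^a)`
— polynomial in `m`, consistent with the calibration that everything provable so far about
`S(per_m)` lives at polynomial degree. The rays `m < j < m²` (where a late start would prove
`stub_atomLate`, `…RayCriterion.stub_atomLate_of_nullcone_inseparable`) are NOT touched here;
the natural next witnesses there are the column-collapsed permanents `per_m(x_{ik} ↦ y_{i,b(k)})`
on `j = m·r` variables (`r ∣ m`), whose polystability follows from BI 2017 Prop. 2.8 in the same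
way as for `per_m` itself.

Honest framing: unconditional structure theorems about `S(per_m)` at polynomial degree;
`stub_atomLate` (`c ≥ 2`), K1 and `GenFlipThesis` remain OPEN; nothing here bears on VP versus
VNP. References: [BurgisserIkenmeyer2017] Cor. 2.9, Def. 3.3; [BurgisserHuttenhainIkenmeyer2017]
§2 (the Chow variety inside the orbit closure); [MulmuleySohoni2001] §4 (`End·f ⊆ Δ(f)`).
-/

set_option linter.dupNamespace false

noncomputable section

namespace Summit.ValiantsHypothesis.ValiantsHypothesis.Theorems.GeneratorObstructions.PerGenDegreeSuperQP

open MvPolynomial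
open Literature.NumberTheory.DiophantineGeometry Literature.Computability.AlgebraicComplexity
  Literature.Computability.Complexity

/-! ### 1. The permanent as a sum over permutations; row-collapse onto a balanced monomial -/

section Collapse

variable {j a : ℕ}

/-- `per_n` on the lexicographic matrix variables, expanded over permutations:
`per_n = ∑_σ ∏_i x_{σ(i), i}`. [folklore] -/
theorem perFormLex_eq_sum (n : ℕ) :
    MvPolynomial.rename (toLex : Fin n × Fin n → MatIdx n) (perPoly (Fin n) ℂ) =
      ∑ σ : Equiv.Perm (Fin n), ∏ i : Fin n, X (toLex (σ i, i)) := by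
  unfold perPoly Matrix.permanent
  simp [map_sum, map_prod, Matrix.mvPolynomialX]

/-- The balanced column labelling `c : Fin (j·a) → Fin j`, `c(k) = k / a` read through
`finProdFinEquiv`: a product over all columns of a function of the label is the `a`-th power of
the product over the labels. [folklore] -/
theorem prod_comp_colLabel {M : Type*} [CommMonoid M] (g : Fin j → M) :
    ∏ k : Fin (j * a), g (finProdFinEquiv.symm k).1 = (∏ s : Fin j, g s) ^ a := by
  rw [← Fintype.prod_equiv finProdFinEquiv (fun p : Fin j × Fin a => g p.1)
    (fun k => g (finProdFinEquiv.symm k).1) (fun p => by simp)]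
  rw [Fintype.prod_prod_type, ← Finset.prod_pow]
  refine Finset.prod_congr rfl fun s _ => ?_
  simp [Finset.prod_const, Fintype.card_fin]

/-- **Row collapse of the permanent onto a balanced monomial.** Substituting for `x_{ik}` the
diagonal variable `x_{(e c(k), e c(k))}` (`c` the balanced labelling of the `j·a` columns by `j`
labels, `e : Fin j ↪ Fin (ja)` the initial segment) — a renaming of variables along a self-map
of the matrix positions — gives `(ja)! · (∏_s x_{(e s, e s)})^a`. [folklore] -/
theorem rename_rowCollapse_perFormLex (hja : j ≤ j * a) :
    MvPolynomial.rename
        (fun x : MatIdx (j * a) =>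
          (toLex (Fin.castLE hja (finProdFinEquiv.symm (ofLex x).2).1,
            Fin.castLE hja (finProdFinEquiv.symm (ofLex x).2).1) : MatIdx (j * a)))
        (MvPolynomial.rename (toLex : Fin (j * a) × Fin (j * a) → MatIdx (j * a))
          (perPoly (Fin (j * a)) ℂ)) =
      ((j * a).factorial : ℂ) •
        (∏ s : Fin j, X (toLex (Fin.castLE hja s, Fin.castLE hja s) : MatIdx (j * a))) ^ a := by
  rw [perFormLex_eq_sum, map_sum]
  trans ∑ _σ : Equiv.Perm (Fin (j * a)),
    (∏ s : Fin j, X (toLex (Fin.castLE hja s, Fin.castLE hja s) : MatIdx (j * a))) ^ a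
  · refine Finset.sum_congr rfl fun σ _ => ?_
    rw [map_prod]
    simp only [rename_X, ofLex_toLex]
    exact prod_comp_colLabel (a := a)
      (fun s => (X (toLex (Fin.castLE hja s, Fin.castLE hja s)) : MvPolynomial (MatIdx (j * a)) ℂ))
  · rw [Finset.sum_const, Finset.card_univ, Fintype.card_perm, Fintype.card_fin,
      ← Nat.cast_smul_eq_nsmul ℂ]

/-- The balanced monomial `(y₁⋯y_j)^a` placed on the diagonal matrix variables
`(e s, e s)`, `s < j`. [folklore] -/
theorem rename_diag_prod_X_pow (hja : j ≤ j * a) :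
    MvPolynomial.rename (fun s : Fin j => (toLex (Fin.castLE hja s, Fin.castLE hja s) : MatIdx (j * a)))
        ((∏ s : Fin j, X s) ^ a : MvPolynomial (Fin j) ℂ) =
      (∏ s : Fin j, X (toLex (Fin.castLE hja s, Fin.castLE hja s) : MatIdx (j * a))) ^ a := by
  simp [map_pow, map_prod, rename_X]

/-- **The balanced monomial is a degeneration of the permanent**: `(y₁⋯y_j)^a`, placed on `j`
diagonal matrix variables, lies in `Δ(per_{ja})` (`a ≥ 1`) — the row collapse is a point of the
endomorphism orbit and `Δ` is a cone. [cite: MulmuleySohoni2001, §4] -/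
theorem balancedMonomial_mem_orbitClosure_per (hj : 0 < j) (ha : 0 < a) (hja : j ≤ j * a) :
    MvPolynomial.rename (fun s : Fin j => (toLex (Fin.castLE hja s, Fin.castLE hja s) : MatIdx (j * a)))
        ((∏ s : Fin j, X s) ^ a : MvPolynomial (Fin j) ℂ) ∈
      orbitClosure (MvPolynomial.rename (toLex : Fin (j * a) × Fin (j * a) → MatIdx (j * a))
        (perPoly (Fin (j * a)) ℂ)) := by
  haveI : Infinite ℂ := CharZero.infinite ℂ
  rw [rename_diag_prod_X_pow hja]
  have hmem := rename_mem_orbitClosure_of_selfMap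
    (fun x : MatIdx (j * a) =>
      (toLex (Fin.castLE hja (finProdFinEquiv.symm (ofLex x).2).1,
        Fin.castLE hja (finProdFinEquiv.symm (ofLex x).2).1) : MatIdx (j * a)))
    (MvPolynomial.rename (toLex : Fin (j * a) × Fin (j * a) → MatIdx (j * a)) (perPoly (Fin (j * a)) ℂ))
  rw [rename_rowCollapse_perFormLex hja] at hmem
  have hm : 0 < j * a := Nat.mul_pos hj ha
  have h := smul_mem_orbitClosure (perFormLex_isHomogeneous (j * a)) hm hmem
    (((j * a).factorial : ℂ))⁻¹
  rwa [smul_smul, inv_mul_cancel₀ (by exact_mod_cast (Nat.factorial_pos _).ne'), one_smul] at h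

end Collapse

/-! ### 2. The Chow rays of `S(per_m)` are hit and start with an atom -/

section Rays

variable {j a : ℕ}

/-- `(y₁⋯y_j)^a` is a form of degree `j a`. [folklore] -/
theorem isHomogeneous_prod_X_pow (j a : ℕ) :
    ((∏ s : Fin j, X s) ^ a : MvPolynomial (Fin j) ℂ).IsHomogeneous (j * a) := by
  have h1 : ((∏ s : Fin j, X s : MvPolynomial (Fin j) ℂ)).IsHomogeneous j := by
    have := IsHomogeneous.prod (Finset.univ : Finset (Fin j)) (fun s => (X s : MvPolynomial (Fin j) ℂ))
      (fun _ => 1) (fun s _ => isHomogeneous_X ℂ s)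
    simpa using this
  simpa using h1.pow a

/-- `(y₁⋯y_j)^a ≠ 0`. [folklore] -/
theorem prod_X_pow_ne_zero (j a : ℕ) :
    ((∏ s : Fin j, X s) ^ a : MvPolynomial (Fin j) ℂ) ≠ 0 := by
  rw [show (∏ s : Fin j, X s : MvPolynomial (Fin j) ℂ) = monomial (∑ s : Fin j, Finsupp.single s 1) 1
    from by rw [monomial_sum_one]; rfl, monomial_pow, one_pow]
  exact monomial_eq_zero.not.mpr one_ne_zero

/-- **The Chow rays are hit.** For every factorisation `m = j·a` with `j, a ≥ 1`, the rectangular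
ray `j` of the occurrence monoid `S(per_m)` is hit: `(k^j)^*` occurs in `ℂ[Δ_m[per_m]]` for some
`k ≥ 1`. Witness: the balanced monomial `(y₁⋯y_j)^a ∈ Δ(per_m)` on `j` of the variables, which is
polystable (BI 2017 Cor. 2.9), hence `SL_j`-semistable; then the ray criterion.
[cite: BurgisserIkenmeyer2017, Cor. 2.9] -/
theorem per_ray_hit_of_mul (hj : 0 < j) (ha : 0 < a) :
    ∃ k : ℕ, 0 < k ∧
      highestWeightSpace (orbitCoordRep (MvPolynomial.rename toLex (perPoly (Fin (j * a)) ℂ)) (j * a))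
        (partitionWeightLex (j * a) (Nat.Partition.rectangle j k)) ≠ ⊥ := by
  have hja : j ≤ j * a := Nat.le_mul_of_pos_right j ha
  have hm : j * a ≠ 0 := (Nat.mul_pos hj ha).ne'
  have hκ : Function.Injective
      (fun s : Fin j => (toLex (Fin.castLE hja s, Fin.castLE hja s) : MatIdx (j * a))) := by
    intro s s' h
    have := congrArg (fun x : MatIdx (j * a) => (ofLex x).1) h
    simpa using this
  obtain ⟨k, hk, hocc⟩ := exists_hasHighestWeight_rectangle_of_isSLSemistable_projection
    (matIdxEquiv (j * a)) hm (perFormLex_isHomogeneous (j * a)) hj _ hκ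
    (isHomogeneous_prod_X_pow j a) (balancedMonomial_mem_orbitClosure_per hj ha hja)
    ((isPolystable_prod_X_pow j a ha).isSLSemistable (prod_X_pow_ne_zero j a))
  exact ⟨k, hk, hocc⟩

/-- **Each Chow ray carries an atom.** For `m = j·a`, `j, a ≥ 1`, the occurrence monoid
`S(per_m)` has an ATOM of the shape `(k₀^j)^*`, `k₀ ≥ 1` — the first weight on the ray `j`
(`exists_least_rectangle_atom`), in degree `j k₀ / m ≤ e((y₁⋯y_j)^a)`. [cite: BurgisserIkenmeyer2017, Cor. 2.9 and Def. 3.3] -/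
theorem per_exists_ray_atom_of_mul (hj : 0 < j) (ha : 0 < a) :
    ∃ k₀ : ℕ, 0 < k₀ ∧
      highestWeightSpace (orbitCoordRep (MvPolynomial.rename toLex (perPoly (Fin (j * a)) ℂ)) (j * a))
        (partitionWeightLex (j * a) (Nat.Partition.rectangle j k₀)) ≠ ⊥ ∧
      (∀ k : ℕ, 0 < k → k < k₀ →
        highestWeightSpace (orbitCoordRep (MvPolynomial.rename toLex (perPoly (Fin (j * a)) ℂ)) (j * a))
          (partitionWeightLex (j * a) (Nat.Partition.rectangle j k)) = ⊥) ∧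
      (∀ χ₁ χ₂ : Weight (MatIdx (j * a)), χ₁ + χ₂ = partitionWeightLex (j * a) (Nat.Partition.rectangle j k₀) →
        χ₁ ≠ 0 → χ₂ ≠ 0 →
        highestWeightSpace (orbitCoordRep (MvPolynomial.rename toLex (perPoly (Fin (j * a)) ℂ)) (j * a)) χ₁ = ⊥ ∨
          highestWeightSpace (orbitCoordRep (MvPolynomial.rename toLex (perPoly (Fin (j * a)) ℂ)) (j * a)) χ₂ = ⊥) :=
  exists_least_rectangle_atom _ _ hj
    ((Nat.le_mul_of_pos_right j ha).trans (Nat.le_mul_of_pos_right _ (Nat.mul_pos hj ha)))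
    (per_ray_hit_of_mul hj ha)

end Rays

end Summit.ValiantsHypothesis.ValiantsHypothesis.Theorems.GeneratorObstructions.PerGenDegreeSuperQP

end
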